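import Summits.QuantumAdvantage.QuantumAdvantage.Theorems.CubicForrelationNearExactIsExactKtGapTwoCubic

/-!
# Crux `CubicForrelation.NearExactIsExact` (stmt-QuantumAdvantage-14043) — the SECOND Kasami–Tokura gap of cubics up to `m = 16`: no Boolean
  function of degree `≤ 3` on `m ≤ 16` bits has weight strictly between `7·2^{m-5}` and `7.5·2^{m-5}` (none on 14 bits in `(3584, 3840)`,
  none on 16 bits in `(14336, 15360)`)

Certificate seat `b2b-cforr-cert` (gen 18).  HONEST FRAMING: a coding-theory BRICK (standard axioms, no `decide`), extending the closing arithmetic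
of `…KtGapTwoCubic.lean` (`m ≤ 12`) to `m ≤ 16` so that the brick also serves the slices `n = 14, 16` (as gen 16's `kt_gap_cubic_le_sixteen` did
for the first gap).  NOT summit progress; no new value of any `θ_n`.

`ktg2_t_sq_le`: Parseval and the count alone give `32 t² ≤ 175·2^k + 18 t` (drop the larger squares), so with `2^k ∣ t²` only one or two values
of `t` survive for each `k`; `ktg2_no_solution_eight … _eleven` close them exactly as in `…KtGapTwoCubic.lean` (Parseval + count reduce to
`p₁B + q₁C = r₁`, mostly with `r₁ < 0`; the few remaining cases die by the exact elimination of the fourth moment and integrality of `n₁`);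
the closure constraint `C + 1 = 2^j` is not even needed beyond `k = 6`.  `kt_gap2_cubic_le_sixteen`, `kt_gap2_fourteen`, `kt_gap2_sixteen`.
(Numerically the same closing works for every `k ≤ 15`, HOME/b2b-cforr-cert-g18/kt2/dioph2.py; a uniform closing in the style of
`ktg_no_solution_all` is left open.)

References: T. Kasami, N. Tokura, IEEE Trans. IT 16 (1970) 752–759 (Thm 1); MacWilliams–Sloane (1977) Ch. 15 §3.  Axioms: standard.
-/

set_option linter.dupNamespace false -- D-0017: single-problem summit ⇒ `QuantumAdvantage.QuantumAdvantage` by design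

noncomputable section

namespace Summit.QuantumAdvantage.QuantumAdvantage.Theorems.CubicForrelation.NearExactIsExact

open Finset
open Literature.Computability.QuantumComplexity

/-! ### Parseval bound on `t` -/

/-- **Parseval kills large `t`**: with `A + B + C + 1 = 32·2^k`, `A t² + B (2^k + t)² + C (3·2^k + t)² + w² = 32·2^k·w` and `w = 7·2^k + t`,
dropping the larger squares gives `32 t² ≤ 175·2^k + 18 t`. [this work] -/
theorem ktg2_t_sq_le (k w t A B C : ℕ) (hw : w = 7 * 2 ^ k + t) (hABC : A + B + C + 1 = 32 * 2 ^ k)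
    (hP : A * t ^ 2 + B * (2 ^ k + t) ^ 2 + C * (3 * 2 ^ k + t) ^ 2 + w ^ 2 = 32 * 2 ^ k * w) : 32 * (t * t) ≤ 175 * 2 ^ k + 18 * t := by
  have hL : 0 < 2 ^ k := Nat.two_pow_pos k
  have h1 : B * t ^ 2 ≤ B * (2 ^ k + t) ^ 2 := Nat.mul_le_mul_left _ (Nat.pow_le_pow_left (by omega) 2)
  have h2 : C * t ^ 2 ≤ C * (3 * 2 ^ k + t) ^ 2 := Nat.mul_le_mul_left _ (Nat.pow_le_pow_left (by omega) 2)
  have h3 : (A + B + C) * t ^ 2 + w ^ 2 ≤ 32 * 2 ^ k * w := by nlinarith [h1, h2, hP]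
  have h4 : (A + B + C + 1) * t ^ 2 = 32 * 2 ^ k * t ^ 2 := by rw [hABC]
  have h5 : 2 ^ k * (32 * (t * t)) ≤ 2 ^ k * (175 * 2 ^ k + 18 * t) := by
    subst hw
    nlinarith [h3, h4]
  exact Nat.le_of_mul_le_mul_left h5 hL

/-! ### The closing arithmetic for `k = 8, 9, 10, 11` (`m = 13 … 16`) -/

/-- `k = 8` (`m = 13`): `2^8 ∣ t²`, `2t < 2^8` and the Parseval bound `32t² ≤ 175·2^8 + 18t` leave `t ∈ {16, 32}`;
`t = 16` dies by Parseval + count (`9B + 75C = 1153` has no solution); at `t = 32` (`w = 1824`) Parseval + count give `5B + 39C = 197`, `Σ I` gives `3n₁ + n₂ = 11965` and the fourth moment `96 n₁ = 87971 + 205B + 12207C` has no integral solution. [this work] -/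
theorem ktg2_no_solution_eight (w t A B C n₁ n₂ n₃ P : ℕ) (hw : w = 7 * 2 ^ 8 + t) (ht : 0 < t)
    (h2 : 2 * t < 2 ^ 8) (hdvd : 2 ^ 8 ∣ t * t) (hABC : A + B + C + 1 = 32 * 2 ^ 8)
    (hP : A * t ^ 2 + B * (2 ^ 8 + t) ^ 2 + C * (3 * 2 ^ 8 + t) ^ 2 + w ^ 2 = 32 * 2 ^ 8 * w)
    (hn : n₁ + n₂ + n₃ + 1 = 32 * 2 ^ 8) (hI : n₁ * (3 * 2 ^ 8 + t) + n₂ * (2 ^ 8 + t) + n₃ * t + w = w ^ 2)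
    (h4 : w ^ 4 + A * t ^ 4 + B * (2 ^ 8 + t) ^ 4 + C * (3 * 2 ^ 8 + t) ^ 4 =
      32 * 2 ^ 8 * (w ^ 2 + n₁ * (3 * 2 ^ 8 + t) ^ 2 + n₂ * (2 ^ 8 + t) ^ 2 + n₃ * t ^ 2))
    (hC : C + 1 = P) : False := by
  have htt := ktg2_t_sq_le 8 w t A B C hw hABC hP
  have hst : 2 ^ 4 ∣ t := by have := ktg_two_pow_dvd_of_sq (a := 8) (by simpa using hdvd); simpa using this
  obtain ⟨q, rfl⟩ : ∃ q, t = 16 * q := ⟨t / 16, by norm_num at hst; omega⟩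
  have hq : q < 3 := by
    clear h4 hI hn hP hABC hdvd hC ht h2
    norm_num at htt
    nlinarith [htt]
  interval_cases q
  · omega
  · subst hw; norm_num at hP hABC; clear h4 hI hn; omega
  · subst hw; norm_num at hP hI h4 hABC hn
    have e1 : 5 * B + 39 * C = 197 := by clear h4 hI hn; omega
    have e2 : 3 * n₁ + n₂ = 11965 := by clear h4 hP hABC; omega
    have key : 96 * n₁ = 87971 + 205 * B + 12207 * C := by linarith
    clear h4 hP hI
    omega

/-- `k = 9` (`m = 14`): `2^9 ∣ t²`, `2t < 2^9` and the Parseval bound `32t² ≤ 175·2^9 + 18t` leave `t ∈ {32}`;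
at `t = 32` (`w = 3616`) Parseval + count give `3B + 25C = 299`, `Σ I` gives `3n₁ + n₂ = 24507` and the fourth moment `128 n₁ = 258693 + 435B + 30025C` has no integral solution. [this work] -/
theorem ktg2_no_solution_nine (w t A B C n₁ n₂ n₃ P : ℕ) (hw : w = 7 * 2 ^ 9 + t) (ht : 0 < t)
    (h2 : 2 * t < 2 ^ 9) (hdvd : 2 ^ 9 ∣ t * t) (hABC : A + B + C + 1 = 32 * 2 ^ 9)
    (hP : A * t ^ 2 + B * (2 ^ 9 + t) ^ 2 + C * (3 * 2 ^ 9 + t) ^ 2 + w ^ 2 = 32 * 2 ^ 9 * w)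
    (hn : n₁ + n₂ + n₃ + 1 = 32 * 2 ^ 9) (hI : n₁ * (3 * 2 ^ 9 + t) + n₂ * (2 ^ 9 + t) + n₃ * t + w = w ^ 2)
    (h4 : w ^ 4 + A * t ^ 4 + B * (2 ^ 9 + t) ^ 4 + C * (3 * 2 ^ 9 + t) ^ 4 =
      32 * 2 ^ 9 * (w ^ 2 + n₁ * (3 * 2 ^ 9 + t) ^ 2 + n₂ * (2 ^ 9 + t) ^ 2 + n₃ * t ^ 2))
    (hC : C + 1 = P) : False := by
  have htt := ktg2_t_sq_le 9 w t A B C hw hABC hP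
  have hst : 2 ^ 5 ∣ t := by have := ktg_two_pow_dvd_of_sq (a := 9) (by simpa using hdvd); simpa using this
  obtain ⟨q, rfl⟩ : ∃ q, t = 32 * q := ⟨t / 32, by norm_num at hst; omega⟩
  have hq : q < 2 := by
    clear h4 hI hn hP hABC hdvd hC ht h2
    norm_num at htt
    nlinarith [htt]
  interval_cases q
  · omega
  · subst hw; norm_num at hP hI h4 hABC hn
    have e1 : 3 * B + 25 * C = 299 := by clear h4 hI hn; omega
    have e2 : 3 * n₁ + n₂ = 24507 := by clear h4 hP hABC; omega
    have key : 128 * n₁ = 258693 + 435 * B + 30025 * C := by linarith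
    clear h4 hP hI
    omega

/-- `k = 10` (`m = 15`): `2^10 ∣ t²`, `2t < 2^10` and the Parseval bound `32t² ≤ 175·2^10 + 18t` leave `t ∈ {32, 64}`;
at `t = 32` (`w = 7200`) Parseval + count give `17B + 147C = 2297`, `Σ I` gives `3n₁ + n₂ = 49594` and the fourth moment `1536 n₁ = 6512423 + 9265B + 691635C` has no integral solution; `t = 64` dies by Parseval + count (`9B + 75C = 385` has no solution). [this work] -/
theorem ktg2_no_solution_ten (w t A B C n₁ n₂ n₃ P : ℕ) (hw : w = 7 * 2 ^ 10 + t) (ht : 0 < t)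
    (h2 : 2 * t < 2 ^ 10) (hdvd : 2 ^ 10 ∣ t * t) (hABC : A + B + C + 1 = 32 * 2 ^ 10)
    (hP : A * t ^ 2 + B * (2 ^ 10 + t) ^ 2 + C * (3 * 2 ^ 10 + t) ^ 2 + w ^ 2 = 32 * 2 ^ 10 * w)
    (hn : n₁ + n₂ + n₃ + 1 = 32 * 2 ^ 10) (hI : n₁ * (3 * 2 ^ 10 + t) + n₂ * (2 ^ 10 + t) + n₃ * t + w = w ^ 2)
    (h4 : w ^ 4 + A * t ^ 4 + B * (2 ^ 10 + t) ^ 4 + C * (3 * 2 ^ 10 + t) ^ 4 =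
      32 * 2 ^ 10 * (w ^ 2 + n₁ * (3 * 2 ^ 10 + t) ^ 2 + n₂ * (2 ^ 10 + t) ^ 2 + n₃ * t ^ 2))
    (hC : C + 1 = P) : False := by
  have htt := ktg2_t_sq_le 10 w t A B C hw hABC hP
  have hst : 2 ^ 5 ∣ t := by have := ktg_two_pow_dvd_of_sq (a := 10) (by simpa using hdvd); simpa using this
  obtain ⟨q, rfl⟩ : ∃ q, t = 32 * q := ⟨t / 32, by norm_num at hst; omega⟩
  have hq : q < 3 := by
    clear h4 hI hn hP hABC hdvd hC ht h2
    norm_num at htt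
    nlinarith [htt]
  interval_cases q
  · omega
  · subst hw; norm_num at hP hI h4 hABC hn
    have e1 : 17 * B + 147 * C = 2297 := by clear h4 hI hn; omega
    have e2 : 3 * n₁ + n₂ = 49594 := by clear h4 hP hABC; omega
    have key : 1536 * n₁ = 6512423 + 9265 * B + 691635 * C := by linarith
    clear h4 hP hI
    omega
  · subst hw; norm_num at hP hABC; clear h4 hI hn; omega

/-- `k = 11` (`m = 16`): `2^11 ∣ t²`, `2t < 2^11` and the Parseval bound `32t² ≤ 175·2^11 + 18t` leave `t ∈ {64}`;
at `t = 64` (`w = 14400`) Parseval + count give `17B + 147C = 1785`, `Σ I` gives `3n₁ + n₂ = 99195` and the fourth moment `768 n₁ = 6518055 + 9265B + 691635C` has no integral solution. [this work] -/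
theorem ktg2_no_solution_eleven (w t A B C n₁ n₂ n₃ P : ℕ) (hw : w = 7 * 2 ^ 11 + t) (ht : 0 < t)
    (h2 : 2 * t < 2 ^ 11) (hdvd : 2 ^ 11 ∣ t * t) (hABC : A + B + C + 1 = 32 * 2 ^ 11)
    (hP : A * t ^ 2 + B * (2 ^ 11 + t) ^ 2 + C * (3 * 2 ^ 11 + t) ^ 2 + w ^ 2 = 32 * 2 ^ 11 * w)
    (hn : n₁ + n₂ + n₃ + 1 = 32 * 2 ^ 11) (hI : n₁ * (3 * 2 ^ 11 + t) + n₂ * (2 ^ 11 + t) + n₃ * t + w = w ^ 2)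
    (h4 : w ^ 4 + A * t ^ 4 + B * (2 ^ 11 + t) ^ 4 + C * (3 * 2 ^ 11 + t) ^ 4 =
      32 * 2 ^ 11 * (w ^ 2 + n₁ * (3 * 2 ^ 11 + t) ^ 2 + n₂ * (2 ^ 11 + t) ^ 2 + n₃ * t ^ 2))
    (hC : C + 1 = P) : False := by
  have htt := ktg2_t_sq_le 11 w t A B C hw hABC hP
  have hst : 2 ^ 6 ∣ t := by have := ktg_two_pow_dvd_of_sq (a := 11) (by simpa using hdvd); simpa using this
  obtain ⟨q, rfl⟩ : ∃ q, t = 64 * q := ⟨t / 64, by norm_num at hst; omega⟩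
  have hq : q < 2 := by
    clear h4 hI hn hP hABC hdvd hC ht h2
    norm_num at htt
    nlinarith [htt]
  interval_cases q
  · omega
  · subst hw; norm_num at hP hI h4 hABC hn
    have e1 : 17 * B + 147 * C = 1785 := by clear h4 hI hn; omega
    have e2 : 3 * n₁ + n₂ = 99195 := by clear h4 hP hABC; omega
    have key : 768 * n₁ = 6518055 + 9265 * B + 691635 * C := by linarith
    clear h4 hP hI
    omega
/-- **No solution for `k ≤ 11`.**  `…KtGapTwoCubic.lean`'s `ktg2_no_solution` (`k ≤ 7`) together with the four lemmas above. [this work] -/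
theorem ktg2_no_solution_le_eleven (k : ℕ) (hk : k ≤ 11) (w t A B C n₁ n₂ n₃ j : ℕ) (hw : w = 7 * 2 ^ k + t) (ht : 0 < t)
    (h2 : 2 * t < 2 ^ k) (hdvd : 2 ^ k ∣ t * t) (hABC : A + B + C + 1 = 32 * 2 ^ k)
    (hP : A * t ^ 2 + B * (2 ^ k + t) ^ 2 + C * (3 * 2 ^ k + t) ^ 2 + w ^ 2 = 32 * 2 ^ k * w)
    (hn : n₁ + n₂ + n₃ + 1 = 32 * 2 ^ k) (hI : n₁ * (3 * 2 ^ k + t) + n₂ * (2 ^ k + t) + n₃ * t + w = w ^ 2)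
    (h4 : w ^ 4 + A * t ^ 4 + B * (2 ^ k + t) ^ 4 + C * (3 * 2 ^ k + t) ^ 4 =
      32 * 2 ^ k * (w ^ 2 + n₁ * (3 * 2 ^ k + t) ^ 2 + n₂ * (2 ^ k + t) ^ 2 + n₃ * t ^ 2))
    (hC : C + 1 = 2 ^ j) : False := by
  rcases Nat.lt_or_ge k 8 with hk7 | hk8
  · exact ktg2_no_solution k (by omega) w t A B C n₁ n₂ n₃ j hw ht h2 hdvd hABC hP hn hI h4 hC
  obtain ⟨P, hPj⟩ : ∃ P, 2 ^ j = P := ⟨_, rfl⟩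
  rw [hPj] at hC
  clear hPj
  obtain ⟨i, hi, rfl⟩ : ∃ i, i ≤ 3 ∧ k = 8 + i := ⟨k - 8, by omega, by omega⟩
  interval_cases i
  · exact ktg2_no_solution_eight w t A B C n₁ n₂ n₃ P hw ht h2 hdvd hABC hP hn hI h4 hC
  · exact ktg2_no_solution_nine w t A B C n₁ n₂ n₃ P hw ht h2 hdvd hABC hP hn hI h4 hC
  · exact ktg2_no_solution_ten w t A B C n₁ n₂ n₃ P hw ht h2 hdvd hABC hP hn hI h4 hC
  · exact ktg2_no_solution_eleven w t A B C n₁ n₂ n₃ P hw ht h2 hdvd hABC hP hn hI h4 hC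

/-! ### The second gap, by induction on `m ≤ 16` -/

/-- **The second Kasami–Tokura gap of cubics for `m ≤ 16`.**  No Boolean function of degree `≤ 3` on `m ≤ 16` bits has
`7·2^m < 32·#{c = 1}` and `64·#{c = 1} < 15·2^m` (weight strictly between `1.75 d` and `1.875 d`, `d = 2^{m-3}`).  NOT summit progress.
[this work; cite: KasamiTokura1970 Thm 1, MacWilliamsSloane1977 Ch. 15 §3] -/
theorem kt_gap2_cubic_le_sixteen : ∀ m ≤ 16, ∀ c : (Fin m → Bool) → Bool, IsDegLeFun 3 c →
    ¬ (7 * 2 ^ m < 32 * #(univ.filter fun x => c x = true) ∧ 64 * #(univ.filter fun x => c x = true) < 15 * 2 ^ m) := by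
  intro m
  induction m with
  | zero => intro _ c _ h; simp only [pow_zero] at h; omega
  | succ m ihm =>
    intro hm c hc h
    rcases Nat.lt_or_ge m 4 with hm4 | hm4
    · obtain ⟨h1, h2⟩ := h
      interval_cases m <;> norm_num at h1 h2 <;> omega
    · obtain ⟨k, rfl⟩ : ∃ k, m = k + 4 := ⟨m - 4, by omega⟩
      have hk : k ≤ 11 := by omega
      have hN : 2 ^ (k + 4 + 1) = 32 * 2 ^ k := by ring
      rw [hN] at h
      have ih' : ∀ c' : (Fin (k + 4) → Bool) → Bool, IsDegLeFun 3 c' →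
          ¬ (7 * 2 ^ k < 2 * #(univ.filter fun y => c' y = true) ∧ 4 * #(univ.filter fun y => c' y = true) < 15 * 2 ^ k) := by
        intro c' hc' h'
        have hN4 : 2 ^ (k + 4) = 16 * 2 ^ k := by ring
        refine ihm (by omega) c' hc' ?_
        rw [hN4]; omega
      obtain ⟨w, t, A, B, C, n₁, n₂, n₃, j, hwS, hwt, hdvd, hABC, hP, hn, hI, h4, hC⟩ :=
        ktg2_step k ih' c hc (by omega) (by omega)
      exact ktg2_no_solution_le_eleven k hk w t A B C n₁ n₂ n₃ j hwt (by omega) (by omega) hdvd hABC hP hn hI h4 hC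

/-- **No cubic Boolean function on 14 bits has weight in `(3584, 3840)`** (for the type-O branch of the `n = 14` slice).  NOT summit progress.
[this work] -/
theorem kt_gap2_fourteen (c : (Fin (7 + 7) → Bool) → Bool) (hc : IsDegLeFun 3 c)
    (h1 : 3584 < #(univ.filter fun x => c x = true)) (h2 : #(univ.filter fun x => c x = true) < 3840) : False :=
  kt_gap2_cubic_le_sixteen (7 + 7) (by norm_num) c hc ⟨by norm_num; omega, by norm_num; omega⟩

/-- **No cubic Boolean function on 16 bits has weight in `(14336, 15360)`** (for the type-O branch of the `n = 16` slice).  NOT summit progress.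
[this work] -/
theorem kt_gap2_sixteen (c : (Fin (8 + 8) → Bool) → Bool) (hc : IsDegLeFun 3 c)
    (h1 : 14336 < #(univ.filter fun x => c x = true)) (h2 : #(univ.filter fun x => c x = true) < 15360) : False :=
  kt_gap2_cubic_le_sixteen (8 + 8) (by norm_num) c hc ⟨by norm_num; omega, by norm_num; omega⟩

end Summit.QuantumAdvantage.QuantumAdvantage.Theorems.CubicForrelation.NearExactIsExact

end
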